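import Summits.BirchSwinnertonDyer.BirchSwinnertonDyer.Theorems.SignedLowerHalvesSmallImageLowerHalfBothSignsRttJunctionFrobenius
import Summits.BirchSwinnertonDyer.BirchSwinnertonDyer.Theorems.SignedLowerHalvesSmallImageLowerHalfBothSignsRttJunctionBinomial
import HarnessLib

/-!
# Route `SignedLowerHalves`, crux L `SmallImageLowerHalfBothSigns` (stmt-BirchSwinnertonDyer-23599), line `rtt_w3` v21 → v22 — E2, junction row J2⁺
# (THE LOCAL PACKAGE, unramified half (L1) ASSEMBLED): THE FROBENIUS DEPLETION `∏_{w ∈ T} ([φ_w] − u_w)` MAPS honda's `𝐇¹ = I.H` INTO -w3's STRICT CARRIER AT `T`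

INPUTS hand `bsd-inputs-honda-p1` g26 under LEAD `cruxlead-stmt-BirchSwinnertonDyer-23599` g12 (cell `bsd-ssimc`; BRIEF-E2 rev 6 §1 (L1), §2 «J2⁺ = THE LOCAL PACKAGE»,
MEMO v22-design §3 stub S1 «∀ b : I.H, junctionE • b ∈ B′»); helper `--supports stmt-BirchSwinnertonDyer-23599`. THEOREMS ONLY: no definition, no named fact, no
instance, no `sorry`. HONEST FRAMING: this is the (L1)-half of S1 — the places of `S₀K` OFF `P = ram(θ′) ∪ {v}`; the places of `S₀K ∩ P` ((L2): `𝐇¹_Iw(K_w, T*) = 0`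
at ramified `w`) are NOT treated here, nor the Euler-factor identity / non-vanishing of the depletion. E2, crux L, crux M and BSD remain OPEN and are proved for NO curve.

* §1 `cycLayerConjO_comm` (the conjugations commute on the layers: `Γ_K/U_n` is abelian through `κ`), `cycLayerConjO_cycLayerScalarO`,
  `proj_frobDepletion_smul` (the level-`(n,k)` component of `((1+T)^x − C a) • b` is `conj_φ y − a • y`, `y = proj b`, when `γ^{x mod pⁿ} φ⁻¹ ∈ U_n`).
* §2 ★★ `locNK_cycLayerConjO_proj_frobDepletion_smul` — **the Frobenius depletion factor `P_w = [φ_w] − u(φ_w)` kills `loc_w ∘ conj_δ` of every level component of every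
  `b ∈ I.H`** (`w ∉ P`; file `…RttJunctionFrobenius`), ★★★ `prod_frobDepletion_smul_mem_strictCarrier` — for a finite set `T` of places off `P`, Frobenius elements `φ_w`
  and exponents `x_w`, and ANY `S₀ ⊆ T`: `(∏_{w∈T} P_w) • b ∈ strictCarrier I (strictLevel S κ θ′ P S₀) _` for every `b`, and its packaged form
  ★★★ `exists_frobDepletion_smul_mem_strictCarrier` (the Frobenius elements and exponents EXIST: `exists_isArithFrobAt_of_mem_primesAbove_holds`, `κ γ` a unit).
References: [PerrinRiou1994Invent] §1.3; [Rubin2000] App. B.3; [NeukirchSchmidtWingberg2008] (8.6.2)–(8.6.3); [JohnsonLeungKings2011] §4.2, §5.1.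
-/

set_option autoImplicit false
set_option linter.dupNamespace false -- D-0017: single-problem summit, the namespace repeats the problem name by design
noncomputable section

open scoped Classical
open NumberField IsDedekindDomain Field PowerSeries

namespace Summit.BirchSwinnertonDyer.BirchSwinnertonDyer.Theorems.SmallImageRttJunctionLocal

open Literature.NumberTheory.EllipticCurves Literature.NumberTheory.GaloisRepresentations
  Literature.NumberTheory.ComplexMultiplication.EllipticUnits
  Literature.NumberTheory.ComplexMultiplication.EllipticUnits.JohnsonLeungKings2011
  Summit.BirchSwinnertonDyer.BirchSwinnertonDyer.Theorems.SmallImageRttD2J1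
  Summit.BirchSwinnertonDyer.BirchSwinnertonDyer.Theorems.SmallImageRttD2Seq

/-! ## §1. Level bookkeeping: commuting conjugations, scalars, and the depletion factor on a level -/

section Level

variable {K : Type} [Field K] [NumberField K] {p : ℕ} [Fact p.Prime] (S : Set (PadicAlgCl p)) (κ : ZpExtension K p)
  (θ' : absoluteGaloisGroup K →ₜ* (padicCoeffIntegers S)ˣ) (P : Set (HeightOneSpectrum (𝓞 K)))

/-- **The conjugations commute on the layer groups**: `Γ_K` acts on `H¹(G_P(K_n), X_k)` through the abelian group `Γ_K / U_n ↪ ℤ_p / pⁿ` (the commutator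
`(gδ)⁻¹(δg)` lies in `ker κ ≤ U_n` and acts trivially). [cite: SerreLocalFields1979, VII §5 Prop. 3] [cite: Washington1997, §13.2] -/
theorem cycLayerConjO_comm (n k : ℕ) (δ g : absoluteGaloisGroup K) (y : cycLayerCohO S κ θ' P n k 1) :
    cycLayerConjO S κ θ' P n k 1 δ (cycLayerConjO S κ θ' P n k 1 g y) = cycLayerConjO S κ θ' P n k 1 g (cycLayerConjO S κ θ' P n k 1 δ y) := by
  have hc : (g * δ)⁻¹ * (δ * g) ∈ κ.layerSubgroup n := by
    refine κ.kerSubgroup_le_layerSubgroup n ?_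
    rw [ZpExtension.mem_kerSubgroup, map_mul, map_inv, map_mul, map_mul, mul_comm (κ δ) (κ g), inv_mul_cancel]
  have hdg : δ * g = g * δ * ((g * δ)⁻¹ * (δ * g)) := by rw [mul_inv_cancel_left]
  unfold cycLayerConjO
  calc levelConjO S P θ' (κ.layerSubgroup n) k 1 δ (levelConjO S P θ' (κ.layerSubgroup n) k 1 g y)
        = levelConjO S P θ' (κ.layerSubgroup n) k 1 (δ * g) y := levelConjO_levelConjO S P θ' k 1 δ g y
    _ = levelConjO S P θ' (κ.layerSubgroup n) k 1 (g * δ) (levelConjO S P θ' (κ.layerSubgroup n) k 1 ((g * δ)⁻¹ * (δ * g)) y) := by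
          rw [levelConjO_levelConjO, ← hdg]
    _ = levelConjO S P θ' (κ.layerSubgroup n) k 1 (g * δ) y := by
          rw [levelConjO_eq_self_of_mem S P θ' hc (κ.isOpen_layerSubgroup n) k (by norm_num)]
    _ = levelConjO S P θ' (κ.layerSubgroup n) k 1 g (levelConjO S P θ' (κ.layerSubgroup n) k 1 δ y) :=
          (levelConjO_levelConjO S P θ' k 1 g δ y).symm

omit [NumberField K] in
/-- The conjugations commute with the `𝒪`-scalars on the layer groups. [cite: JohnsonLeungKings2011, §4.2 (arXiv p0012:L72–76, L109–112)] -/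
theorem cycLayerConjO_cycLayerScalarO (n k : ℕ) (δ : absoluteGaloisGroup K) (a : padicCoeffIntegers S) (y : cycLayerCohO S κ θ' P n k 1) :
    cycLayerConjO S κ θ' P n k 1 δ (cycLayerScalarO S κ θ' P n k 1 a y) = cycLayerScalarO S κ θ' P n k 1 a (cycLayerConjO S κ θ' P n k 1 δ y) :=
  (levelScalarO_levelConjO S P θ' (κ.layerSubgroup n) k 1 a δ y).symm

variable {S κ θ' P} in
/-- **The depletion factor on a level**: for `γ^{x mod pⁿ} g⁻¹ ∈ U_n`, the level-`(n,k)` component of `((1+T)^x − C a) • b` is `conj_g (proj b) − a • proj b`.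
[cite: JohnsonLeungKings2011, §4.2, §5.1] [cite: PerrinRiou1994Invent, §1.3] -/
theorem proj_frobDepletion_smul {γ : absoluteGaloisGroup K} (I : CycIwasawaCohomologyDataO S κ γ θ' P 1) {x₁ : ℤ_[p]} {n : ℕ} {g : absoluteGaloisGroup K}
    (hg : γ ^ (PadicInt.toZModPow n x₁).val * g⁻¹ ∈ κ.layerSubgroup n) (k : ℕ) (a : padicCoeffIntegers S) (b : I.H) :
    I.proj n k ((iwasawaToIwasawaO S (binomialSeries ℤ_[p] x₁) - PowerSeries.C a) • b) =
      cycLayerConjO S κ θ' P n k 1 g (I.proj n k b) - cycLayerScalarO S κ θ' P n k 1 a (I.proj n k b) := by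
  rw [sub_smul, map_sub, proj_binomialSeries_smul_eq_cycLayerConjO I (by norm_num) hg, I.proj_C_smul]

end Level

/-! ## §2. The Frobenius depletion maps `𝐇¹` into the strict carrier at the places off `P` -/

section Depletion

variable {K : Type} [Field K] [NumberField K] {p : ℕ} [Fact p.Prime] (S : Set (PadicAlgCl p)) (κ : ZpExtension K p) {γ : absoluteGaloisGroup K}
  (θ' : absoluteGaloisGroup K →ₜ* (padicCoeffIntegers S)ˣ) (P : Set (HeightOneSpectrum (𝓞 K)))

/-- ★★ **The Frobenius depletion factor `P_w = (1+T)^{x_w} − C u(φ_w)` kills `loc_w ∘ conj_δ` of every level component of every `b ∈ 𝐇¹ = I.H`** (`w ∉ P`,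
`φ_w` an arithmetic Frobenius at the prime above `w` cut out by `K̄ → K̄_w`, `γ^{x_w mod pⁿ} φ_w⁻¹ ∈ U_n` for all `n`, `u(φ) = θ′(φ)·χ_cyc(φ)`): the component is
`conj_φ y − u(φ) • y` (`proj_frobDepletion_smul`), conjugations and scalars commute with `conj_δ`, and `loc_w (conj_φ y′) = loc_w (u(φ) • y′)` (file
`…RttJunctionFrobenius`). [cite: PerrinRiou1994Invent, §1.3] [cite: Rubin2000, App. B.3] [cite: NeukirchSchmidtWingberg2008, (8.6.2)] -/
theorem locNK_cycLayerConjO_proj_frobDepletion_smul {w : HeightOneSpectrum (𝓞 K)} (hw : w ∉ P) (hNP : ∀ n, ramificationSubgroup K P ≤ κ.layerSubgroup n)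
    {φ : absoluteGaloisGroup K} (hφ : IsArithFrobAt (𝓞 K) φ (adicCompletionPrime K w)) (I : CycIwasawaCohomologyDataO S κ γ θ' P 1) {x₁ : ℤ_[p]}
    (hx : ∀ n, γ ^ (PadicInt.toZModPow n x₁).val * φ⁻¹ ∈ κ.layerSubgroup n) (b : I.H) (n k : ℕ) (δ : absoluteGaloisGroup K) :
    locNK S κ θ' P w n k (cycLayerConjO S κ θ' P n k 1 δ (I.proj n k
      ((iwasawaToIwasawaO S (binomialSeries ℤ_[p] x₁) -
        PowerSeries.C (((θ' φ : (padicCoeffIntegers S)ˣ) : padicCoeffIntegers S) *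
          padicIntToCoeffIntegers S ((GaloisRep.cyclotomicCharacter K p φ : ℤ_[p]ˣ) : ℤ_[p]))) • b))) = 0 := by
  rw [proj_frobDepletion_smul I (hx n), map_sub, cycLayerConjO_comm, cycLayerConjO_cycLayerScalarO, map_sub,
    locNK_cycLayerConjO_eq_locNK_cycLayerScalarO_of_isArithFrobAt S κ θ' P w hw hNP hφ, sub_self]

/-- ★★★ **THE FROBENIUS DEPLETION MAPS `𝐇¹` INTO THE STRICT CARRIER** ((L1)-half of the LEAD's stub S1 «`∀ b, E • b ∈ B′`»): for a finite set `T` of places OFF `P`,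
Frobenius elements `φ_w` (at the primes above `w ∈ T` cut out by the chosen embeddings) with exponents `x_w` (`γ^{x_w mod pⁿ} φ_w⁻¹ ∈ U_n`), and every `S₀ ⊆ T`:
`(∏_{w ∈ T} ((1+T)^{x_w} − C u(φ_w))) • b ∈ strictCarrier I (strictLevel S κ θ′ P S₀) _` for EVERY `b ∈ I.H` — all localisations above `S₀` of all level
components vanish (-w3's `mem_strictCarrier_strictLevel_iff`), the factor at `w` doing the killing (`locNK_cycLayerConjO_proj_frobDepletion_smul`, commutativity of
`Λ_𝒪`). [cite: PerrinRiou1994Invent, §1.3] [cite: Rubin2000, Thm. 1.7.3, App. B.3] [cite: NeukirchSchmidtWingberg2008, (8.6.2)–(8.6.3)] -/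
theorem prod_frobDepletion_smul_mem_strictCarrier (T : Finset (HeightOneSpectrum (𝓞 K))) (S₀ : Set (HeightOneSpectrum (𝓞 K))) (hS₀ : S₀ ⊆ ↑T)
    (hT : ∀ w ∈ T, w ∉ P) (hNP : ∀ n, ramificationSubgroup K P ≤ κ.layerSubgroup n)
    (φ : HeightOneSpectrum (𝓞 K) → absoluteGaloisGroup K) (hφ : ∀ w ∈ T, IsArithFrobAt (𝓞 K) (φ w) (adicCompletionPrime K w))
    (x : HeightOneSpectrum (𝓞 K) → ℤ_[p]) (hx : ∀ w ∈ T, ∀ n, γ ^ (PadicInt.toZModPow n (x w)).val * (φ w)⁻¹ ∈ κ.layerSubgroup n)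
    (I : CycIwasawaCohomologyDataO S κ γ θ' P 1)
    (hStr : ∀ (n k : ℕ) (f : IwasawaAlgebraO S) (y : cycLayerCohO S κ θ' P n k 1), y ∈ strictLevel S κ θ' P S₀ n k →
      (letI := cycLayerModuleO S κ γ θ' P (show 1 ≤ 2 by norm_num) n k; f • y) ∈ strictLevel S κ θ' P S₀ n k)
    (b : I.H) :
    (∏ w ∈ T, (iwasawaToIwasawaO S (binomialSeries ℤ_[p] (x w)) -
        PowerSeries.C (((θ' (φ w) : (padicCoeffIntegers S)ˣ) : padicCoeffIntegers S) *
          padicIntToCoeffIntegers S ((GaloisRep.cyclotomicCharacter K p (φ w) : ℤ_[p]ˣ) : ℤ_[p])))) • b ∈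
      strictCarrier I (strictLevel S κ θ' P S₀) hStr := by
  refine (mem_strictCarrier_strictLevel_iff S I S₀ _).mpr fun n k w hw δ ↦ ?_
  rw [← Finset.mul_prod_erase T _ (hS₀ hw), mul_smul]
  exact locNK_cycLayerConjO_proj_frobDepletion_smul S κ θ' P (hT w (hS₀ hw)) hNP (hφ w (hS₀ hw)) I (hx w (hS₀ hw)) _ n k δ

/-- ★★★ **Packaged: for `κ γ` a unit of `ℤ_p` (a topological generator up to a unit — honda's frame has `γ = γK⁻¹`) and a finite set `T` of places off `P`,
THERE ARE Frobenius elements `φ_w` and exponents `x_w` whose depletion `∏_{w∈T} ((1+T)^{x_w} − C u(φ_w))` maps EVERY `b ∈ 𝐇¹` into the strict carrier at every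
`S₀ ⊆ T`** (Frobenius elements exist at every prime of `\bar ℤ_K`: tree `exists_isArithFrobAt_of_mem_primesAbove_holds`; exponents: `pow_toZModPow_val_mul_inv_mem_layerSubgroup`).
[cite: PerrinRiou1994Invent, §1.3] [cite: Rubin2000, Thm. 1.7.3, App. B.3] [cite: NeukirchANT1999, I §9 Prop. (9.4)] -/
theorem exists_frobDepletion_smul_mem_strictCarrier {a : ℤ_[p]ˣ} (hγ : (κ γ).toAdd = a) (T : Finset (HeightOneSpectrum (𝓞 K)))
    (hT : ∀ w ∈ T, w ∉ P) (hNP : ∀ n, ramificationSubgroup K P ≤ κ.layerSubgroup n) (I : CycIwasawaCohomologyDataO S κ γ θ' P 1) :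
    ∃ (φ : HeightOneSpectrum (𝓞 K) → absoluteGaloisGroup K) (x : HeightOneSpectrum (𝓞 K) → ℤ_[p]),
      (∀ w ∈ T, IsArithFrobAt (𝓞 K) (φ w) (adicCompletionPrime K w)) ∧
      (∀ w ∈ T, ∀ n, γ ^ (PadicInt.toZModPow n (x w)).val * (φ w)⁻¹ ∈ κ.layerSubgroup n) ∧
      (∀ w, x w = ((a⁻¹ : ℤ_[p]ˣ) : ℤ_[p]) * (κ (φ w)).toAdd) ∧
      ∀ (S₀ : Set (HeightOneSpectrum (𝓞 K))) (hS₀ : S₀ ⊆ ↑T)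
        (hStr : ∀ (n k : ℕ) (f : IwasawaAlgebraO S) (y : cycLayerCohO S κ θ' P n k 1), y ∈ strictLevel S κ θ' P S₀ n k →
          (letI := cycLayerModuleO S κ γ θ' P (show 1 ≤ 2 by norm_num) n k; f • y) ∈ strictLevel S κ θ' P S₀ n k) (b : I.H),
        (∏ w ∈ T, (iwasawaToIwasawaO S (binomialSeries ℤ_[p] (x w)) -
            PowerSeries.C (((θ' (φ w) : (padicCoeffIntegers S)ˣ) : padicCoeffIntegers S) *
              padicIntToCoeffIntegers S ((GaloisRep.cyclotomicCharacter K p (φ w) : ℤ_[p]ˣ) : ℤ_[p])))) • b ∈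
          strictCarrier I (strictLevel S κ θ' P S₀) hStr := by
  -- Frobenius elements at the primes `𝔓₀(w)` above every place
  have hF : ∀ w : HeightOneSpectrum (𝓞 K), ∃ φ : absoluteGaloisGroup K, IsArithFrobAt (𝓞 K) φ (adicCompletionPrime K w) := fun w ↦
    IsDedekindDomain.HeightOneSpectrum.exists_isArithFrobAt_of_mem_primesAbove_holds (adicCompletionPrime_mem_primesAbove K w)
  choose φ hφ using hF
  refine ⟨φ, fun w ↦ ((a⁻¹ : ℤ_[p]ˣ) : ℤ_[p]) * (κ (φ w)).toAdd, fun w _ ↦ hφ w,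
    fun w _ n ↦ pow_toZModPow_val_mul_inv_mem_layerSubgroup hγ (φ w) n, fun _ ↦ rfl, fun S₀ hS₀ hStr b ↦ ?_⟩
  exact prod_frobDepletion_smul_mem_strictCarrier S κ θ' P T S₀ hS₀ hT hNP φ (fun w _ ↦ hφ w) _
    (fun w _ n ↦ pow_toZModPow_val_mul_inv_mem_layerSubgroup hγ (φ w) n) I hStr b

end Depletion

end Summit.BirchSwinnertonDyer.BirchSwinnertonDyer.Theorems.SmallImageRttJunctionLocal

end
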